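import Literature.Barriers.Schanuel.EFunctionValuesAtAlgebraicPointsForms
import Mathlib.RingTheory.PowerSeries.Derivative
import Mathlib.Data.Nat.Choose.Sum
import Mathlib.Algebra.BigOperators.Field
import HarnessLib

/-!
# Barrier (Schanuel) `EFunctionValuesAtAlgebraicPoints`: exponential generating series `∑ aₙ Xⁿ/n!` over a field (Baker Ch. 11 §1) — proofs only

`Literature/Barriers/Schanuel/EFunctionValuesAtAlgebraicPointsEGF.lean` — sibling file of
`EFunctionValuesAtAlgebraicPoints.lean` in the programme to discharge `siegelShidlovskii_algIndep`
(Siegel–Shidlovskii; Rivoal Thm. 5.10 = Baker Thm. 11.1). The formal power series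
`egf a = ∑ aₘ Xᵐ/m! ∈ K⟦X⟧` attached to a coefficient sequence `a : ℕ → K` over a field of
characteristic zero (the number field of Baker Ch. 11 §1: "series of the form `∑ aₙ xⁿ/n!` with
`a₀, a₁, …` elements of an algebraic number field"), and the coefficient bookkeeping used by
Lemmas 1 and 4:

* `SiegelShidlovskii.egf`, `coeff_egf`, `map_egf` (compatibility with field embeddings);
* `derivative_egf` (`(∑ aₘXᵐ/m!)′ = ∑ aₘ₊₁Xᵐ/m!`), `egf_mul_egf` (products are the `egf` of the
  binomial convolution `bconv`, Baker: "products … of E-functions are again E-functions");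
* `coeff_coe_mul_egf` and `coeff_form_egf`: the `N`-th coefficient of `P(X)·egf a` and of a form
  `∑ᵢ Pᵢ · egf aᵢ` is `∑ₛ Pₛ a_{N−s}/(N−s)!` — the identity behind Baker's
  "`ρₘ = (r!/m!) σₘ`" (Ch. 11, proof of Lemma 1, p. 110).

All [folklore]; no named facts.

## References

* A. Baker, *Transcendental Number Theory*, CUP 1975, Ch. 11 §1–§2 (pp. 109–110).
-/

noncomputable section

open PowerSeries
open scoped Nat

namespace Literature.Barriers.Schanuel

namespace SiegelShidlovskii

variable {K : Type*} [Field K]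

/-! ### 1. The series `∑ aₘ Xᵐ / m!` -/

/-- The exponential generating series `∑ aₘ Xᵐ/m!` of a sequence `a`. [folklore] -/
def egf (a : ℕ → K) : PowerSeries K :=
  PowerSeries.mk fun m => a m / (m ! : K)

/-- Coefficients of `egf`. [folklore] -/
@[simp] theorem coeff_egf (a : ℕ → K) (m : ℕ) : coeff m (egf a) = a m / (m ! : K) := by
  simp [egf]

/-- `egf` is additive. [folklore] -/
theorem egf_add (a b : ℕ → K) : egf (fun m => a m + b m) = egf a + egf b := by
  ext m; simp [add_div]

/-- `egf` commutes with constants. [folklore] -/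
theorem egf_const_mul (c : K) (a : ℕ → K) : egf (fun m => c * a m) = PowerSeries.C c * egf a := by
  ext m; simp [mul_div_assoc]

/-- `egf` is compatible with field homomorphisms. [folklore] -/
theorem map_egf {L : Type*} [Field L] (σ : K →+* L) (a : ℕ → K) :
    (egf a).map σ = egf (σ ∘ a) := by
  ext m
  simp [coeff_map, map_div₀, map_natCast]

/-- The zero sequence. [folklore] -/
@[simp] theorem egf_zero : egf (fun _ => (0 : K)) = 0 := by
  ext m; simp

/-- `egf a = 0 ↔ a = 0`. [folklore] -/
theorem egf_eq_zero_iff [CharZero K] (a : ℕ → K) : egf a = 0 ↔ ∀ m, a m = 0 := by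
  constructor
  · intro h m
    have := congr_arg (PowerSeries.coeff m) h
    rw [coeff_egf, map_zero, div_eq_zero_iff] at this
    exact this.resolve_right (by exact_mod_cast Nat.factorial_ne_zero m)
  · intro h; ext m; simp [h m]

/-! ### 2. Derivative and products -/

/-- **`(∑ aₘ Xᵐ/m!)′ = ∑ aₘ₊₁ Xᵐ/m!`.** [folklore] -/
theorem derivative_egf [CharZero K] (a : ℕ → K) : derivative K (egf a) = egf fun m => a (m + 1) := by
  ext m
  rw [coeff_derivative, coeff_egf, coeff_egf, Nat.factorial_succ]
  have h1 : (m ! : K) ≠ 0 := by exact_mod_cast m.factorial_ne_zero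
  have h2 : ((m + 1 : ℕ) : K) ≠ 0 := by exact_mod_cast Nat.succ_ne_zero m
  push_cast
  field_simp

/-- The binomial convolution `(a ⋆ b)ₘ = ∑ₖ C(m,k) aₖ bₘ₋ₖ` over `K`. [folklore] -/
def bconv (a b : ℕ → K) (m : ℕ) : K :=
  ∑ k ∈ Finset.range (m + 1), (m.choose k : K) * a k * b (m - k)

/-- Unfolding `bconv`. [folklore] -/
theorem bconv_apply (a b : ℕ → K) (m : ℕ) :
    bconv a b m = ∑ k ∈ Finset.range (m + 1), (m.choose k : K) * a k * b (m - k) := rfl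

/-- **Products**: `egf a · egf b = egf (a ⋆ b)` (Baker Ch. 11 §1: products of `E`-functions).
[folklore] -/
theorem egf_mul_egf [CharZero K] (a b : ℕ → K) : egf a * egf b = egf (bconv a b) := by
  ext m
  rw [coeff_mul, Finset.Nat.sum_antidiagonal_eq_sum_range_succ_mk, coeff_egf, bconv,
    Finset.sum_div]
  refine Finset.sum_congr rfl fun i hi => ?_
  have him : i ≤ m := Nat.lt_succ_iff.mp (Finset.mem_range.mp hi)
  rw [coeff_egf, coeff_egf, Nat.cast_choose K him]
  have h1 : (i ! : K) ≠ 0 := by exact_mod_cast i.factorial_ne_zero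
  have h2 : ((m - i)! : K) ≠ 0 := by exact_mod_cast (m - i).factorial_ne_zero
  have h3 : (m ! : K) ≠ 0 := by exact_mod_cast m.factorial_ne_zero
  field_simp

/-- `bconv` is compatible with field homomorphisms. [folklore] -/
theorem map_bconv {L : Type*} [Field L] (σ : K →+* L) (a b : ℕ → K) (m : ℕ) :
    σ (bconv a b m) = bconv (σ ∘ a) (σ ∘ b) m := by
  simp [bconv, map_sum]

/-! ### 3. Coefficients of `P(X) · egf a` and of forms -/

/-- **`N`-th coefficient of `P · egf a`**: `∑_{s ≤ N} Pₛ · a_{N−s}/(N−s)!`. [folklore] -/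
theorem coeff_coe_mul_egf (P : Polynomial K) (a : ℕ → K) (N : ℕ) :
    coeff N ((P : PowerSeries K) * egf a) =
      ∑ s ∈ Finset.range (N + 1), P.coeff s * (a (N - s) / ((N - s)! : K)) := by
  rw [coeff_mul, Finset.Nat.sum_antidiagonal_eq_sum_range_succ_mk]
  refine Finset.sum_congr rfl fun s _ => ?_
  rw [Polynomial.coeff_coe, coeff_egf]

/-- **`N`-th coefficient of a form** `∑ᵢ Pᵢ · egf aᵢ`. [folklore] -/
theorem coeff_form_egf {ν : ℕ} (q : Fin ν → Polynomial K) (a : Fin ν → ℕ → K) (N : ℕ) :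
    coeff N (form (coeAlgHom K) (fun i => egf (a i)) q) =
      ∑ i, ∑ s ∈ Finset.range (N + 1), (q i).coeff s * (a i (N - s) / ((N - s)! : K)) := by
  simp only [form, map_sum, coeAlgHom_apply, coeff_coe_mul_egf]

/-- The same coefficient with binomial coefficients: `N! · [X^N](∑ Pᵢ egf aᵢ) =
∑ᵢ ∑ₛ C(N,s) (s! Pᵢₛ) aᵢ(N−s)` (Baker's `ρₘ = (r!/m!) σₘ` for `Pᵢ = r! ∑ pᵢⱼ xʲ/j!`).
[folklore] -/
theorem factorial_mul_coeff_form_egf [CharZero K] {ν : ℕ} (q : Fin ν → Polynomial K) (a : Fin ν → ℕ → K) (N : ℕ) :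
    (N ! : K) * coeff N (form (coeAlgHom K) (fun i => egf (a i)) q) =
      ∑ i, ∑ s ∈ Finset.range (N + 1),
        (N.choose s : K) * (((s ! : K) * (q i).coeff s) * a i (N - s)) := by
  rw [coeff_form_egf, Finset.mul_sum]
  refine Finset.sum_congr rfl fun i _ => ?_
  rw [Finset.mul_sum]
  refine Finset.sum_congr rfl fun s hs => ?_
  have hsN : s ≤ N := Nat.lt_succ_iff.mp (Finset.mem_range.mp hs)
  rw [Nat.cast_choose K hsN]
  have h1 : (s ! : K) ≠ 0 := by exact_mod_cast s.factorial_ne_zero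
  have h2 : ((N - s)! : K) ≠ 0 := by exact_mod_cast (N - s).factorial_ne_zero
  field_simp

end SiegelShidlovskii

end Literature.Barriers.Schanuel

end
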